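import Literature.Algebra.EuclideanLattices.GaussianLatticeSums
import Mathlib.Analysis.InnerProductSpace.Projection.Basic
import HarnessLib

/-!
# The Gaussian mass of a lattice coset is maximal at the lattice itself

Topic `Algebra/EuclideanLattices`, a thin sequel of `GaussianLatticeSums.lean`. That file proves,
from the tree's Poisson summation formula, **Banaszczyk's inequality** `ρ_s(L - x) ≤ ρ_s(L)`
(`tsum_gaussianFunction_sub_le`, `ρ_s(v) = e^{-π‖v‖²/s²}`) for a *full* lattice `L` of a euclidean
space. This file puts it in the forms in which it is quoted elsewhere:

* `tsum_exp_neg_mul_norm_sub_sq_le` — activity form: for every full lattice `L ⊂ V`, `u ∈ V` and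
  `t > 0`, `∑_{x ∈ L} e^{-t‖x - u‖²} ≤ ∑_{x ∈ L} e^{-t‖x‖²}` (`s = √(π/t)`). This is the statement
  "the Gaussian mass of a lattice coset is maximised by the lattice", i.e. `f_{L,s}(u) ≤ 1` for the
  periodic Gaussian `f_{L,s}(u) = ρ_s(L + u)/ρ_s(L)` of Regev–Stephens-Davidowitz
  [RegevStephensdavidowitz2017, §1], and `θ_{Λ+u}(α) ≤ θ_Λ(α)` of Bétermin–Petrache
  [BeterminPetrache2017, Prop. 3.4 (arXiv numbering), "well-known, implicit in Banaszczyk"].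
* `tsum_exp_neg_mul_norm_sum_smul_sub_sq_le` — lattices of ANY rank in ANY real inner product
  space: for a linearly independent family `b : ι → E` (`ι` finite), every `u ∈ E` and `t > 0`,
  `∑_{c ∈ ℤ^ι} e^{-t‖∑ cᵢ bᵢ - u‖²} ≤ ∑_{c ∈ ℤ^ι} e^{-t‖∑ cᵢ bᵢ‖²}` (reduce to the span `F` of `b`,
  a euclidean space in which `⊕ ℤ bᵢ` is a full lattice, splitting off the component of `u`
  orthogonal to `F` by Pythagoras — it only contributes a factor `e^{-t·dist(u,F)²} ≤ 1`), with the
  summability of these sums (`summable_exp_neg_mul_norm_sum_smul_sub_sq`);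
* `tsum_exp_neg_mul_norm_zsmul_add_zsmul_sub_sq_le` (+ `summable_…`) — the two-generator form over
  `ℤ × ℤ`, the shape of the layer sums `∑_{(i,j) ∈ ℤ²} e^{-t‖i a₁ + j a₂ + w‖²}` of stacking
  energies (`MathematicalPhysics/StatisticalMechanics/BarlowStackingEnergy`): a triangular layer
  seen from a laterally offset site has smaller Gaussian layer sum than seen from an aligned site.

Everything is proved; no definitions, no named facts. The four-term inequality
`ρ(L+x)²ρ(L+y)² ≤ ρ(L)²ρ(L+x+y)ρ(L+x-y)` that is the main theorem of [RegevStephensdavidowitz2017]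
(their Thm. 1.1) is NOT here.

## References

* W. Banaszczyk, *New bounds in some transference theorems in the geometry of numbers*, Math. Ann.
  296 (1993) 625–635, Lemma 1.1. [Banaszczyk1993]
* O. Regev, N. Stephens-Davidowitz, *An inequality for Gaussians on lattices*, SIAM J. Discrete
  Math. 31 (2017) 749–757, arXiv:1502.04796, §1 (the periodic Gaussian `f_{L,s}`) and the proof of
  Cor. 2.2 (dual form `f_{L*}(x) = E_{w ∼ D_L}[cos 2π⟨w,x⟩]`). [RegevStephensdavidowitz2017]
* L. Bétermin, M. Petrache, *Dimension reduction techniques for the minimization of theta functions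
  on lattices*, J. Math. Phys. 58 (2017) 071902, arXiv:1607.08716, Def. 3.1 – Prop. 3.4 (arXiv
  numbering): `θ_{Λ+u}(α) ≤ θ_Λ(α)` by Poisson summation. [BeterminPetrache2017]
-/

noncomputable section

open Module Submodule
open scoped Real InnerProductSpace

namespace Literature.Algebra.EuclideanLattices

/-! ## Full lattices: the activity form of `tsum_gaussianFunction_sub_le` -/

section FullRank

variable {V : Type*} [NormedAddCommGroup V]

/-- `ρ_{√(π/t)}(v) = e^{-t‖v‖²}`: the Gaussian `gaussianFunction s` at parameter `s = √(π/t)` is the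
activity-`t` Gaussian. [folklore] -/
theorem gaussianFunction_sqrt_pi_div {t : ℝ} (ht : 0 < t) (v : V) :
    gaussianFunction (Real.sqrt (π / t)) v = Real.exp (-t * ‖v‖ ^ 2) := by
  rw [gaussianFunction, Real.sq_sqrt (div_pos Real.pi_pos ht).le]
  congr 1
  field_simp

/-- Summability of the shifted activity-`t` Gaussian over a discrete subgroup of a
finite-dimensional real normed space (`summable_gaussianFunction_sub`). [folklore] -/
theorem summable_exp_neg_mul_norm_sub_sq [NormedSpace ℝ V] [FiniteDimensional ℝ V]
    (L : Submodule ℤ V) [DiscreteTopology L] {t : ℝ} (ht : 0 < t) (u : V) :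
    Summable fun x : L => Real.exp (-t * ‖(x : V) - u‖ ^ 2) := by
  have hs : Real.sqrt (π / t) ≠ 0 := (Real.sqrt_pos.2 (div_pos Real.pi_pos ht)).ne'
  simpa only [gaussianFunction_sqrt_pi_div ht] using summable_gaussianFunction_sub L hs u

variable [InnerProductSpace ℝ V] [FiniteDimensional ℝ V]

/-- **The Gaussian mass of a coset is at most that of the lattice** (activity form of Banaszczyk's
inequality `ρ_s(L - u) ≤ ρ_s(L)`): for a full lattice `L` of a euclidean space `V`, every `u ∈ V`
and every `t > 0`, `∑_{x ∈ L} e^{-t‖x - u‖²} ≤ ∑_{x ∈ L} e^{-t‖x‖²}`. Equivalently `f_{L,s}(u) ≤ 1`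
(Regev–Stephens-Davidowitz's periodic Gaussian, `s = √(π/t)`) and `θ_{Λ+u}(α) ≤ θ_Λ(α)`
(Bétermin–Petrache, `α = t/π`). From `tsum_gaussianFunction_sub_le` (Poisson summation: the dual
series has nonnegative coefficients times `cos ≤ 1`). [cite: Banaszczyk1993, Lemma 1.1] -/
theorem tsum_exp_neg_mul_norm_sub_sq_le (L : Submodule ℤ V) [DiscreteTopology L] [IsZLattice ℝ L]
    {t : ℝ} (ht : 0 < t) (u : V) :
    ∑' x : L, Real.exp (-t * ‖(x : V) - u‖ ^ 2) ≤ ∑' x : L, Real.exp (-t * ‖(x : V)‖ ^ 2) := by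
  borelize V
  have hs : 0 < Real.sqrt (π / t) := Real.sqrt_pos.2 (div_pos Real.pi_pos ht)
  simpa only [gaussianFunction_sqrt_pi_div ht] using tsum_gaussianFunction_sub_le L hs u

end FullRank

/-! ## Lattices of any rank: linearly independent families in an arbitrary inner product space -/

section Family

variable {E : Type*} [NormedAddCommGroup E] [InnerProductSpace ℝ E] {ι : Type*} [Fintype ι]
  {b : ι → E}

/-- Bookkeeping for a linearly independent family `b`: inside its span `F` (a euclidean space) the
integer combinations `∑ cᵢ bᵢ` are exactly the points of the full lattice `⊕ ℤ bᵢ`, so a sum over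
`c ∈ ℤ^ι` of a function of `∑ cᵢ bᵢ` is a sum over that lattice. [folklore] -/
theorem tsum_comp_sum_smul_eq_tsum_span (hb : LinearIndependent ℝ b) (G : E → ℝ) :
    ∑' c : ι → ℤ, G (∑ i, (c i : ℝ) • b i) =
      ∑' x : span ℤ (Set.range (Basis.span hb)), G (((x : span ℝ (Set.range b)) : E)) := by
  set b' : Basis ι ℝ (span ℝ (Set.range b)) := Basis.span hb with hb'def
  have hb' : ∀ i, ((b' i : span ℝ (Set.range b)) : E) = b i := fun i => by
    rw [hb'def, Basis.span_apply]
  set e : span ℤ (Set.range b') ≃ (ι → ℤ) := (b'.restrictScalars ℤ).equivFun.toEquiv with hedef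
  have he : ∀ c : ι → ℤ, (((e.symm c : span ℤ (Set.range b')) : span ℝ (Set.range b)) : E) =
      ∑ i, (c i : ℝ) • b i := by
    intro c
    have h1 : ((e.symm c : span ℤ (Set.range b')) : span ℝ (Set.range b)) = ∑ i, (c i : ℝ) • b' i :=
      Literature.NumberTheory.LFunctions.Fourier.coe_restrictScalars_equivFun_symm b' c
    rw [h1, Submodule.coe_sum]
    exact Finset.sum_congr rfl fun i _ => by rw [Submodule.coe_smul, hb']
  calc ∑' c : ι → ℤ, G (∑ i, (c i : ℝ) • b i)
      = ∑' c : ι → ℤ, G (((e.symm c : span ℤ (Set.range b')) : span ℝ (Set.range b)) : E) :=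
        tsum_congr fun c => by rw [he]
    _ = ∑' x : span ℤ (Set.range b'), G (((x : span ℝ (Set.range b))) : E) :=
        e.symm.tsum_eq fun x : span ℤ (Set.range b') => G (((x : span ℝ (Set.range b))) : E)

/-- Pythagoras against the span: for `x` in a finite-dimensional subspace `F` and any `u`,
`‖x - u‖² = ‖x - p‖² + ‖u - p‖²` with `p` the orthogonal projection of `u` on `F`. [folklore] -/
theorem norm_coe_sub_sq_eq_add (F : Submodule ℝ E) [F.HasOrthogonalProjection] (x : F) (u : E) :
    ‖(x : E) - u‖ ^ 2 =
      ‖x - F.orthogonalProjectionOnto u‖ ^ 2 + ‖u - (F.orthogonalProjectionOnto u : E)‖ ^ 2 := by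
  have horth : ⟪(x : E) - F.starProjection u, u - F.starProjection u⟫_ℝ = 0 := by
    rw [real_inner_comm]
    exact Submodule.starProjection_inner_eq_zero u _
      (F.sub_mem x.2 (Submodule.starProjection_apply_mem F u))
  have h := norm_sub_sq_eq_norm_sq_add_norm_sq_real horth
  have hx : (x : E) - F.starProjection u - (u - F.starProjection u) = (x : E) - u := by abel
  rw [hx] at h
  rw [Submodule.coe_norm, Submodule.coe_sub, Submodule.coe_orthogonalProjectionOnto_apply, sq, sq,
    sq, h]

/-- **The Gaussian mass of a coset is at most that of the lattice — any rank, any ambient inner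
product space.** For a linearly independent finite family `b` in a real inner product space `E`,
every `u ∈ E` and every `t > 0`:
`∑_{c ∈ ℤ^ι} e^{-t‖∑ cᵢ bᵢ - u‖²} ≤ ∑_{c ∈ ℤ^ι} e^{-t‖∑ cᵢ bᵢ‖²}`.
(Inside the span `F` of `b` the lattice `⊕ ℤ bᵢ` is full and `tsum_exp_neg_mul_norm_sub_sq_le`
applies to the projection `p` of `u`; the orthogonal part of `u` contributes the factor
`e^{-t‖u - p‖²} ≤ 1`.) [cite: Banaszczyk1993, Lemma 1.1] -/
theorem tsum_exp_neg_mul_norm_sum_smul_sub_sq_le (hb : LinearIndependent ℝ b) {t : ℝ} (ht : 0 < t)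
    (u : E) :
    ∑' c : ι → ℤ, Real.exp (-t * ‖∑ i, (c i : ℝ) • b i - u‖ ^ 2) ≤
      ∑' c : ι → ℤ, Real.exp (-t * ‖∑ i, (c i : ℝ) • b i‖ ^ 2) := by
  set F : Submodule ℝ E := span ℝ (Set.range b) with hF
  haveI : FiniteDimensional ℝ F := FiniteDimensional.span_of_finite ℝ (Set.finite_range b)
  haveI : CompleteSpace F := FiniteDimensional.complete ℝ F
  rw [tsum_comp_sum_smul_eq_tsum_span hb fun v => Real.exp (-t * ‖v - u‖ ^ 2),
    tsum_comp_sum_smul_eq_tsum_span hb fun v => Real.exp (-t * ‖v‖ ^ 2)]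
  set L : Submodule ℤ F := span ℤ (Set.range (Basis.span hb)) with hL
  have hfac : ∀ x : L, Real.exp (-t * ‖((x : F) : E) - u‖ ^ 2) =
      Real.exp (-t * ‖u - (F.orthogonalProjectionOnto u : E)‖ ^ 2) *
        Real.exp (-t * ‖(x : F) - F.orthogonalProjectionOnto u‖ ^ 2) := by
    intro x
    rw [norm_coe_sub_sq_eq_add F (x : F) u, ← Real.exp_add]
    ring_nf
  simp only [hfac]
  rw [tsum_mul_left]
  set p : F := F.orthogonalProjectionOnto u with hp
  have hle1 : Real.exp (-t * ‖u - (p : E)‖ ^ 2) ≤ 1 :=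
    Real.exp_le_one_iff.2 (by nlinarith [sq_nonneg ‖u - (p : E)‖])
  have hnonneg : 0 ≤ ∑' x : L, Real.exp (-t * ‖(x : F) - p‖ ^ 2) :=
    tsum_nonneg fun _ => (Real.exp_pos _).le
  calc Real.exp (-t * ‖u - (p : E)‖ ^ 2) * ∑' x : L, Real.exp (-t * ‖(x : F) - p‖ ^ 2)
      ≤ 1 * ∑' x : L, Real.exp (-t * ‖(x : F) - p‖ ^ 2) :=
        mul_le_mul_of_nonneg_right hle1 hnonneg
    _ = ∑' x : L, Real.exp (-t * ‖(x : F) - p‖ ^ 2) := one_mul _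
    _ ≤ ∑' x : L, Real.exp (-t * ‖(x : F)‖ ^ 2) := tsum_exp_neg_mul_norm_sub_sq_le L ht p
    _ = ∑' x : L, Real.exp (-t * ‖((x : F) : E)‖ ^ 2) := by simp only [Submodule.coe_norm]

/-- Summability of `c ↦ e^{-t‖∑ cᵢ bᵢ - u‖²}` over `ℤ^ι` for a linearly independent finite family
`b` (any `u`, `t > 0`). [folklore] -/
theorem summable_exp_neg_mul_norm_sum_smul_sub_sq (hb : LinearIndependent ℝ b) {t : ℝ} (ht : 0 < t)
    (u : E) :
    Summable fun c : ι → ℤ => Real.exp (-t * ‖∑ i, (c i : ℝ) • b i - u‖ ^ 2) := by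
  set F : Submodule ℝ E := span ℝ (Set.range b) with hF
  haveI : FiniteDimensional ℝ F := FiniteDimensional.span_of_finite ℝ (Set.finite_range b)
  haveI : CompleteSpace F := FiniteDimensional.complete ℝ F
  set b' : Basis ι ℝ F := Basis.span hb with hb'def
  have hb' : ∀ i, ((b' i : F) : E) = b i := fun i => by rw [hb'def, Basis.span_apply]
  set L : Submodule ℤ F := span ℤ (Set.range b') with hL
  set e : L ≃ (ι → ℤ) := (b'.restrictScalars ℤ).equivFun.toEquiv with hedef
  have he : ∀ c : ι → ℤ, (((e.symm c : L) : F) : E) = ∑ i, (c i : ℝ) • b i := by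
    intro c
    have h1 : ((e.symm c : L) : F) = ∑ i, (c i : ℝ) • b' i :=
      Literature.NumberTheory.LFunctions.Fourier.coe_restrictScalars_equivFun_symm b' c
    rw [h1, Submodule.coe_sum]
    exact Finset.sum_congr rfl fun i _ => by rw [Submodule.coe_smul, hb']
  -- summable over the lattice `L` of `F`, shift = projection of `u`, times the orthogonal factor
  have hS : Summable fun x : L =>
      Real.exp (-t * ‖u - (F.orthogonalProjectionOnto u : E)‖ ^ 2) *
        Real.exp (-t * ‖(x : F) - F.orthogonalProjectionOnto u‖ ^ 2) :=
    (summable_exp_neg_mul_norm_sub_sq L ht (F.orthogonalProjectionOnto u)).mul_left _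
  have hS' : Summable fun x : L => Real.exp (-t * ‖((x : F) : E) - u‖ ^ 2) := by
    refine hS.congr fun x => ?_
    rw [norm_coe_sub_sq_eq_add F (x : F) u, ← Real.exp_add]
    ring_nf
  -- transport along the coordinate equivalence
  have h := (e.symm.summable_iff (f := fun x : L => Real.exp (-t * ‖((x : F) : E) - u‖ ^ 2))).2 hS'
  refine h.congr fun c => ?_
  simp only [Function.comp_apply, he]

end Family

/-! ## Two generators: sums over `ℤ × ℤ` (layer sums) -/

section TwoGenerators

variable {E : Type*} [NormedAddCommGroup E] [InnerProductSpace ℝ E]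

/-- Reindexing `ℤ × ℤ` by `Fin 2 → ℤ` in a sum of a function of `i a₁ + j a₂`. [folklore] -/
theorem tsum_prod_eq_tsum_fin_two (a₁ a₂ : E) (G : E → ℝ) :
    ∑' ij : ℤ × ℤ, G ((ij.1 : ℝ) • a₁ + (ij.2 : ℝ) • a₂) =
      ∑' c : Fin 2 → ℤ, G (∑ i, (c i : ℝ) • ![a₁, a₂] i) := by
  rw [← (finTwoArrowEquiv ℤ).symm.tsum_eq fun c : Fin 2 → ℤ => G (∑ i, (c i : ℝ) • ![a₁, a₂] i)]
  refine tsum_congr fun ij => ?_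
  simp [finTwoArrowEquiv, Fin.sum_univ_two]

/-- **Layer form of the coset inequality.** For linearly independent `a₁, a₂` in a real inner product
space, every `u` and every `t > 0`:
`∑_{(i,j) ∈ ℤ²} e^{-t‖i a₁ + j a₂ - u‖²} ≤ ∑_{(i,j) ∈ ℤ²} e^{-t‖i a₁ + j a₂‖²}` — a planar lattice
layer has larger Gaussian sum seen from an aligned site than from any offset one (the positivity
`θ_Λ(t) - θ_{Λ+w}(t) ≥ 0` behind one-sign-change stacking arguments, Bétermin–Petrache 2017 §3).
[cite: Banaszczyk1993, Lemma 1.1] -/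
theorem tsum_exp_neg_mul_norm_zsmul_add_zsmul_sub_sq_le {a₁ a₂ : E}
    (h : LinearIndependent ℝ ![a₁, a₂]) {t : ℝ} (ht : 0 < t) (u : E) :
    ∑' ij : ℤ × ℤ, Real.exp (-t * ‖(ij.1 : ℝ) • a₁ + (ij.2 : ℝ) • a₂ - u‖ ^ 2) ≤
      ∑' ij : ℤ × ℤ, Real.exp (-t * ‖(ij.1 : ℝ) • a₁ + (ij.2 : ℝ) • a₂‖ ^ 2) := by
  rw [tsum_prod_eq_tsum_fin_two a₁ a₂ fun v => Real.exp (-t * ‖v - u‖ ^ 2),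
    tsum_prod_eq_tsum_fin_two a₁ a₂ fun v => Real.exp (-t * ‖v‖ ^ 2)]
  exact tsum_exp_neg_mul_norm_sum_smul_sub_sq_le h ht u

/-- Summability of the layer Gaussian `(i, j) ↦ e^{-t‖i a₁ + j a₂ - u‖²}` over `ℤ × ℤ` for linearly
independent `a₁, a₂` (any `u`, `t > 0`). [folklore] -/
theorem summable_exp_neg_mul_norm_zsmul_add_zsmul_sub_sq {a₁ a₂ : E}
    (h : LinearIndependent ℝ ![a₁, a₂]) {t : ℝ} (ht : 0 < t) (u : E) :
    Summable fun ij : ℤ × ℤ => Real.exp (-t * ‖(ij.1 : ℝ) • a₁ + (ij.2 : ℝ) • a₂ - u‖ ^ 2) := by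
  have hS := summable_exp_neg_mul_norm_sum_smul_sub_sq h ht u
  have h2 := ((finTwoArrowEquiv ℤ).symm.summable_iff
    (f := fun c : Fin 2 → ℤ => Real.exp (-t * ‖∑ i, (c i : ℝ) • ![a₁, a₂] i - u‖ ^ 2))).2 hS
  refine h2.congr fun ij => ?_
  simp [finTwoArrowEquiv, Fin.sum_univ_two]

end TwoGenerators

end Literature.Algebra.EuclideanLattices
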